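import Summits.ResolutionOfSingularities.ResolutionOfSingularities.Theorems.FrobeniusClosingPatchingRelPerfectOfAtomDimFour
import Summits.ResolutionOfSingularities.ResolutionOfSingularities.Theorems.FrobeniusClosingPatchingRelPerfectAlgebraizeBlowupForm
import Summits.ResolutionOfSingularities.ResolutionOfSingularities.Theorems.FrobeniusClosingPatchingRelPerfectRoofEngineBlowup
import Summits.ResolutionOfSingularities.ResolutionOfSingularities.Theorems.FrobeniusClosingPatchingRelPerfectSliceOfEngineBlowup
import Summits.ResolutionOfSingularities.ResolutionOfSingularities.Theorems.FrobeniusClosingPatchingRelPerfectCompanionKernel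
import Summits.ResolutionOfSingularities.ResolutionOfSingularities.Theorems.FrobeniusClosingPatchingRelPerfectCJSBlowupFormat
import HarnessLib

/-!
# Crux `PatchingRelPerfect` (stmt-ResolutionOfSingularities-16161), chain w52:
# the crux CLOSED MODULO the BLOW-UP-FORM open core (certificate of the P0 / v4 composition)

[OURS · L1 W5.2 · P0 certificate] With the blow-up-form re-glue stubs landed —
α `stub_algebraizeBlowupForm` (p461871), β `stub_roofEngineBlowup` (this chain),
γ `stub_sliceOfEngineBlowup` (p462067), the W4′ roofs (p461090) and the 080A kernel (p460515 /
p461610) — the planner's v4 composition (CHAIN.md v0.1 §3) is kernel-checked here as a Theorems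
certificate, the blow-up-form analogue of p171172:

* `punctualCompletePerfectBlowup_four_of_printed_of_atomDimFourBlowup` — the complete-side
  blow-up-form atom for bases of dimension `≤ 4` from the printed dimension-`≤ 3` theorems
  (`stub_atomDimLeThree`, proper form ⇒ blow-up form) and its dimension-EXACTLY-4 stratum
  `AtomDimFourBlowupAt p` (THE OPEN CORE of v4, typed target `ChainW52.AtomDimFourBlowupAt`);
* `hasResolution_dimLeFour_of_printed_of_atomDimFourBlowup` — the dimension-`≤ 4` integral slice;
* `patchingRelPerfect_of_printed_of_atomDimFourBlowup_of_dimGeFive` — **the crux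
  `FrobeniusClosing.PatchingRelPerfect` BY NAME from the printed inputs, the blow-up-form open
  core (`∀ p prime, AtomDimFourBlowupAt p`) and the parked dimension-`≥ 5` residual**;
* `patchingRelPerfect_of_printed_of_companions_of_dimGeFive` — the same with the open core
  replaced by the COMPANION statement about ideals of complete regular local fourfold bases
  («every non-zero ideal `I` of `S` whose blowing up is regular off `V(𝔪)` has an `𝔪`-primary
  `Q` with `Bl_{I·Q} Spec S` regular», W2 `w2_companionKernel`);
* `patchingRelPerfect_of_namedFacts_of_companions_of_dimGeFive` — the same with the CJS conjunct
  taken from the named fact `CossartJannsenSaito2020Sequence`.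

All CONDITIONAL (the item stays open); the open inputs are exactly the blow-up-form atom /
companion statement in dimension `4` and the dimension-`≥ 5` residual. HONESTY: the blow-up form
is implied by the registered proper form (`ChainW52.atomDimFourBlowupAt_of_atomDimFourAt`,
planner's sketch) — no standing is claimed to drop. Nothing here is a statement of the manuscript
under review.

## References

* V. Cossart, O. Piltant, J. Algebra 529 (2019), Thm. 1.1, Prop. 4.4; arXiv:1412.0868 §5. [CossartPiltant2019]
* V. Cossart, U. Jannsen, S. Saito, LNM 2270 (2020), Thm. 1.2. [CossartJannsenSaito2020]
* M. Temkin, Adv. Math. 219 (2008), Prop. 2.3.4, Thm. 3.4.1. [Temkin2008]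
* O. Piltant, RACSAM 107 (2013), Prop. 5.1, Cor. 5.7, p. 2. [Piltant2013]
* The Stacks Project, Tags 080A, 080B. [StacksProject]
-/

-- `Summit.<Summit>.<Sub>.Theorems` with `Sub = Summit` (single-conjunct summit, D-0017)
set_option linter.dupNamespace false

noncomputable section

open CategoryTheory CategoryTheory.Limits AlgebraicGeometry Literature.AlgebraicGeometry.Resolution

namespace Summit.ResolutionOfSingularities.ResolutionOfSingularities.Theorems

/-- **The complete-side blow-up-form atom for bases of dimension `≤ 4`** from the printed
dimension-`≤ 3` theorems and the blow-up-form dimension-EXACTLY-4 core: a blowing up of `Spec S`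
along a non-zero ideal is integral, proper and birational (`IsBlowup.isIntegral`, `.isProper`,
`.isBirational'`), so below dimension `4` the landed proper-form `stub_atomDimLeThree` applies; at
dimension `4` (an element of `WithBot ℕ∞` that is `≤ 4` and not `≤ 3`) the core `hA4B` does.
[cite: CossartPiltant2019, Thm. 1.1 and Prop. 4.4; CossartJannsenSaito2020, Thm. 1.2] -/
theorem punctualCompletePerfectBlowup_four_of_printed_of_atomDimFourBlowup (p : ℕ) (hp : p.Prime)
    (hG : CossartPiltant2019General.{0}) (hP : CossartPiltant2019Principalization.{0})
    (hCJS : ∀ (X : Scheme.{0}) [IsNoetherian X] [IsReduced X], Scheme.IsExcellent X →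
      topologicalKrullDim X ≤ 2 → Scheme.AdmitsDesingularization X)
    (hA4B : ∀ (S : Type) [CommRing S] [IsRegularLocalRing S] [CharP S p]
      [IsAdicComplete (IsLocalRing.maximalIdeal S) S]
      [PerfectField (IsLocalRing.ResidueField S)], ringKrullDim S = (4 : ℕ) →
      ∀ (I : Ideal S), I ≠ ⊥ → ∀ (T : Scheme.{0}) (f : T ⟶ Spec (.of S)),
        IsBlowup f (affineBlowup.idealSheaf I) →
        (∀ t : T, f.base t ≠ IsLocalRing.closedPoint S → IsRegularLocalRing (T.presheaf.stalk t)) →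
        ∃ (J : T.IdealSheafData) (T' : Scheme.{0}) (π : T' ⟶ T), J ≠ ⊥ ∧
          (∀ t : T, t ∈ J.support → f.base t = IsLocalRing.closedPoint S) ∧
          IsBlowup π J ∧ Scheme.IsRegular T')
    (S : Type) [CommRing S] [IsRegularLocalRing S] [CharP S p]
    [IsAdicComplete (IsLocalRing.maximalIdeal S) S] [PerfectField (IsLocalRing.ResidueField S)]
    (hdim : ringKrullDim S ≤ (4 : ℕ)) (I : Ideal S) (hI : I ≠ ⊥) (T : Scheme.{0})
    (f : T ⟶ Spec (.of S)) (hf : IsBlowup f (affineBlowup.idealSheaf I))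
    (hoff : ∀ t : T, f.base t ≠ IsLocalRing.closedPoint S →
      IsRegularLocalRing (T.presheaf.stalk t)) :
    ∃ (J : T.IdealSheafData) (T' : Scheme.{0}) (π : T' ⟶ T), J ≠ ⊥ ∧
      (∀ t : T, t ∈ J.support → f.base t = IsLocalRing.closedPoint S) ∧
      IsBlowup π J ∧ Scheme.IsRegular T' := by
  by_cases h3 : ringKrullDim S ≤ (3 : ℕ)
  · haveI : IsDomain S := isDomain_of_isRegularLocalRing S
    have hI' : affineBlowup.idealSheaf I ≠ ⊥ := affineBlowup.idealSheaf_ne_bot hI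
    haveI : IsIntegral T := hf.isIntegral hI'
    haveI : IsProper f := hf.isProper
    exact stub_atomDimLeThree p hp hG hP hCJS S h3 T f (hf.isBirational' hI') hoff
  · exact hA4B S (topologicalKrullDim_eq_four_of_le_four_of_not_le_three hdim h3) I hI T f hf hoff

/-- **The dimension-`≤ 4` integral slice of `PatchingRelPerfect` through the BLOW-UP-FORM
engine**: for every prime `p`, relative local uniformization over perfect fields of characteristic
`p` gives every integral separated scheme of finite type of dimension `≤ 4` over a perfect field of
characteristic `p` a resolution — PROVIDED the printed dimension-`≤ 3` theorems and the
blow-up-form core `AtomDimFourBlowupAt p`. Composition γ ∘ β ∘ α of the P0 stubs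
(`stub_sliceOfEngineBlowup`, `stub_roofEngineBlowup`, `stub_localDesingNonClosed`,
`stub_algebraizeBlowupForm`). CONDITIONAL.
[cite: Temkin2008, Prop. 2.3.4 and Thm. 3.4.1; Piltant2013, Prop. 5.1 and Cor. 5.7;
CossartPiltant2019, Thm. 1.1 and Prop. 4.4] -/
theorem hasResolution_dimLeFour_of_printed_of_atomDimFourBlowup
    (hG : CossartPiltant2019General.{0}) (hP : CossartPiltant2019Principalization.{0})
    (hCJS : ∀ (X : Scheme.{0}) [IsNoetherian X] [IsReduced X], Scheme.IsExcellent X →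
      topologicalKrullDim X ≤ 2 → Scheme.AdmitsDesingularization X)
    (p : ℕ) (hp : p.Prime)
    (hA4B : ∀ (S : Type) [CommRing S] [IsRegularLocalRing S] [CharP S p]
      [IsAdicComplete (IsLocalRing.maximalIdeal S) S]
      [PerfectField (IsLocalRing.ResidueField S)], ringKrullDim S = (4 : ℕ) →
      ∀ (I : Ideal S), I ≠ ⊥ → ∀ (T : Scheme.{0}) (f : T ⟶ Spec (.of S)),
        IsBlowup f (affineBlowup.idealSheaf I) →
        (∀ t : T, f.base t ≠ IsLocalRing.closedPoint S → IsRegularLocalRing (T.presheaf.stalk t)) →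
        ∃ (J : T.IdealSheafData) (T' : Scheme.{0}) (π : T' ⟶ T), J ≠ ⊥ ∧
          (∀ t : T, t ∈ J.support → f.base t = IsLocalRing.closedPoint S) ∧
          IsBlowup π J ∧ Scheme.IsRegular T')
    (hLU : ∀ (k K : Type) [Field k] [CharP k p] [PerfectField k] [Field K] [Algebra k K],
      (⊤ : IntermediateField k K).FG → ∀ O : ValuationSubring K, (∀ c : k, algebraMap k K c ∈ O) →
        ∀ R : Subalgebra k K, R.FG → R.toSubring ≤ O.toSubring →
          ∃ (A : Subalgebra k K) (h : A.toSubring ≤ O.toSubring), R ≤ A ∧ A.FG ∧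
            IsFractionRing A K ∧ IsRegularLocalRing (Localization.AtPrime
              (Ideal.comap (Subring.inclusion h) (IsLocalRing.maximalIdeal O))))
    (k : Type) [Field k] [CharP k p] [PerfectField k] (X : Scheme.{0}) (f : X ⟶ Spec (.of k))
    [IsSeparated f] [LocallyOfFiniteType f] [QuasiCompact f] [IsIntegral X]
    (hX : topologicalKrullDim X ≤ 4) : Scheme.HasResolution X :=
  stub_sliceOfEngineBlowup p hp hG hP hLU
    (fun k₁ _ _ _ M g _ _ _ _ hdim hroof =>
      stub_roofEngineBlowup p hp
        (fun k₂ _ M₂ g₂ _ _ _ _ hdim₂ ζ hζ X' f' J hf' =>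
          stub_localDesingNonClosed hG hP k₂ M₂ g₂ hdim₂ ζ hζ X' f' J hf')
        (fun k₃ _ _ _ S _ _ _ _ hdimS hfin I hI T fT hfT hoff =>
          @stub_algebraizeBlowupForm p hp
            (fun S' _ _ _ _ _ hdim' I' hI' T' f' hf' hoff' =>
              @punctualCompletePerfectBlowup_four_of_printed_of_atomDimFourBlowup p hp hG hP hCJS
                hA4B S' _ _ _ _ _ hdim' I' hI' T' f' hf' hoff')
            k₃ _ _ _ S _ _ _ _ hdimS hfin I hI T fT hfT hoff)
        k₁ M g hdim hroof)
    k X f hX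

/-- **The crux `FrobeniusClosing.PatchingRelPerfect` BY NAME from the printed dimension-`≤ 3`
theorems, the BLOW-UP-FORM open core `∀ p prime, AtomDimFourBlowupAt p`, and the dimension-`≥ 5`
residual** — the certificate of the planner's v4 composition (P0, CHAIN.md v0.1 §3), blow-up-form
analogue of `patchingRelPerfect_of_printed_of_atomDimFour_of_dimGeFive` (p171172). Reduce
resolution over one perfect `k` to integral closed subschemes over the same `k`
(`hasResolution_of_forall_closeds`) and split on `topologicalKrullDim ≤ 4`. CONDITIONAL; the item
stays open. [cite: CossartPiltant2019, Thm. 1.1 and Prop. 4.4; CossartJannsenSaito2020, Thm. 1.2;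
Temkin2008, Prop. 2.3.4; Piltant2013, p. 2] -/
theorem patchingRelPerfect_of_printed_of_atomDimFourBlowup_of_dimGeFive
    (hG : CossartPiltant2019General.{0}) (hP : CossartPiltant2019Principalization.{0})
    (hCJS : ∀ (X : Scheme.{0}) [IsNoetherian X] [IsReduced X], Scheme.IsExcellent X →
      topologicalKrullDim X ≤ 2 → Scheme.AdmitsDesingularization X)
    (hA4B : ∀ (p : ℕ), p.Prime → ∀ (S : Type) [CommRing S] [IsRegularLocalRing S] [CharP S p]
      [IsAdicComplete (IsLocalRing.maximalIdeal S) S]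
      [PerfectField (IsLocalRing.ResidueField S)], ringKrullDim S = (4 : ℕ) →
      ∀ (I : Ideal S), I ≠ ⊥ → ∀ (T : Scheme.{0}) (f : T ⟶ Spec (.of S)),
        IsBlowup f (affineBlowup.idealSheaf I) →
        (∀ t : T, f.base t ≠ IsLocalRing.closedPoint S → IsRegularLocalRing (T.presheaf.stalk t)) →
        ∃ (J : T.IdealSheafData) (T' : Scheme.{0}) (π : T' ⟶ T), J ≠ ⊥ ∧
          (∀ t : T, t ∈ J.support → f.base t = IsLocalRing.closedPoint S) ∧
          IsBlowup π J ∧ Scheme.IsRegular T')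
    (h5 : ∀ (p : ℕ), p.Prime →
      (∀ (k K : Type) [Field k] [CharP k p] [PerfectField k] [Field K] [Algebra k K],
        (⊤ : IntermediateField k K).FG → ∀ O : ValuationSubring K, (∀ c : k, algebraMap k K c ∈ O) →
          ∀ R : Subalgebra k K, R.FG → R.toSubring ≤ O.toSubring →
            ∃ (A : Subalgebra k K) (h : A.toSubring ≤ O.toSubring), R ≤ A ∧ A.FG ∧
              IsFractionRing A K ∧ IsRegularLocalRing (Localization.AtPrime
                (Ideal.comap (Subring.inclusion h) (IsLocalRing.maximalIdeal O)))) →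
      ∀ (k : Type) [Field k] [CharP k p] [PerfectField k] (X : Scheme.{0}) (f : X ⟶ Spec (.of k)),
        IsSeparated f → LocallyOfFiniteType f → QuasiCompact f → IsIntegral X →
        ¬ topologicalKrullDim X ≤ 4 → Scheme.HasResolution X) :
    Summit.ResolutionOfSingularities.ResolutionOfSingularities.Theses.FrobeniusClosing.PatchingRelPerfect := by
  intro p hp hLU k _ _ _ X f hsep hft hqc hred
  haveI := hft; haveI := hqc; haveI := hred
  refine hasResolution_of_forall_closeds X f fun Z hZ => ?_
  haveI := hZ
  let ι := (Scheme.IdealSheafData.vanishingIdeal Z).subschemeι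
  by_cases hd : topologicalKrullDim ↥(Scheme.IdealSheafData.vanishingIdeal Z).subscheme ≤ 4
  · exact hasResolution_dimLeFour_of_printed_of_atomDimFourBlowup hG hP hCJS p hp (hA4B p hp)
      hLU k _ (ι ≫ f) hd
  · exact h5 p hp hLU k _ (ι ≫ f) inferInstance inferInstance inferInstance hZ hd

/-- **The crux BY NAME from the printed inputs, REGULARIZING COMPANIONS in dimension `4`, and the
dimension-`≥ 5` residual.** The open core is replaced by the statement the atlas / disprover can
compute with (W2, `w2_companionKernel`): for every complete regular local `S` of dimension `4`,
characteristic `p`, perfect residue field, and every non-zero ideal `I ⊆ S` whose blowing up is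
regular off the closed fibre, SOME `𝔪`-primary `Q ⊇ 𝔪ⁿ` has `Bl_{(I·Q)~} Spec S` regular.
CONDITIONAL; the item stays open. [cite: StacksProject, Tag 080A]
[cite: CossartPiltant2019, Thm. 1.1 and Prop. 4.4] [cite: Piltant2013, p. 2] -/
theorem patchingRelPerfect_of_printed_of_companions_of_dimGeFive
    (hG : CossartPiltant2019General.{0}) (hP : CossartPiltant2019Principalization.{0})
    (hCJS : ∀ (X : Scheme.{0}) [IsNoetherian X] [IsReduced X], Scheme.IsExcellent X →
      topologicalKrullDim X ≤ 2 → Scheme.AdmitsDesingularization X)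
    (hQ : ∀ (p : ℕ), p.Prime → ∀ (S : Type) [CommRing S] [IsRegularLocalRing S] [CharP S p]
      [IsAdicComplete (IsLocalRing.maximalIdeal S) S]
      [PerfectField (IsLocalRing.ResidueField S)], ringKrullDim S = (4 : ℕ) →
      ∀ (I : Ideal S), I ≠ ⊥ → ∀ (T : Scheme.{0}) (f : T ⟶ Spec (.of S)),
        IsBlowup f (affineBlowup.idealSheaf I) →
        (∀ t : T, f.base t ≠ IsLocalRing.closedPoint S → IsRegularLocalRing (T.presheaf.stalk t)) →
        ∃ (Q : Ideal S) (n : ℕ), (IsLocalRing.maximalIdeal S) ^ n ≤ Q ∧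
          ∃ (B : Scheme.{0}) (b : B ⟶ Spec (.of S)),
            IsBlowup b (affineBlowup.idealSheaf (I * Q)) ∧ Scheme.IsRegular B)
    (h5 : ∀ (p : ℕ), p.Prime →
      (∀ (k K : Type) [Field k] [CharP k p] [PerfectField k] [Field K] [Algebra k K],
        (⊤ : IntermediateField k K).FG → ∀ O : ValuationSubring K, (∀ c : k, algebraMap k K c ∈ O) →
          ∀ R : Subalgebra k K, R.FG → R.toSubring ≤ O.toSubring →
            ∃ (A : Subalgebra k K) (h : A.toSubring ≤ O.toSubring), R ≤ A ∧ A.FG ∧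
              IsFractionRing A K ∧ IsRegularLocalRing (Localization.AtPrime
                (Ideal.comap (Subring.inclusion h) (IsLocalRing.maximalIdeal O)))) →
      ∀ (k : Type) [Field k] [CharP k p] [PerfectField k] (X : Scheme.{0}) (f : X ⟶ Spec (.of k)),
        IsSeparated f → LocallyOfFiniteType f → QuasiCompact f → IsIntegral X →
        ¬ topologicalKrullDim X ≤ 4 → Scheme.HasResolution X) :
    Summit.ResolutionOfSingularities.ResolutionOfSingularities.Theses.FrobeniusClosing.PatchingRelPerfect :=
  patchingRelPerfect_of_printed_of_atomDimFourBlowup_of_dimGeFive hG hP hCJS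
    (fun p hp S _ _ _ _ _ hdim I hI T f hf hoff => by
      haveI : IsDomain S := isDomain_of_isRegularLocalRing S
      obtain ⟨Q, n, hQn, hB⟩ := hQ p hp S hdim I hI T f hf hoff
      exact w2_companionKernel S I hI T f hf Q n hQn hB)
    h5

/-- The same with the CJS conjunct from the NAMED FACT `CossartJannsenSaito2020Sequence`: the
crux BY NAME from three named facts of the tree, regularizing companions in dimension `4` (OPEN),
and the dimension-`≥ 5` residual (PARKED). CONDITIONAL.
[cite: CossartPiltant2019, Thm. 1.1 and Prop. 4.4] [cite: CossartJannsenSaito2020, Thm. 1.2] -/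
theorem patchingRelPerfect_of_namedFacts_of_companions_of_dimGeFive
    (hG : CossartPiltant2019General.{0}) (hP : CossartPiltant2019Principalization.{0})
    (hS : CossartJannsenSaito2020Sequence.{0})
    (hQ : ∀ (p : ℕ), p.Prime → ∀ (S : Type) [CommRing S] [IsRegularLocalRing S] [CharP S p]
      [IsAdicComplete (IsLocalRing.maximalIdeal S) S]
      [PerfectField (IsLocalRing.ResidueField S)], ringKrullDim S = (4 : ℕ) →
      ∀ (I : Ideal S), I ≠ ⊥ → ∀ (T : Scheme.{0}) (f : T ⟶ Spec (.of S)),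
        IsBlowup f (affineBlowup.idealSheaf I) →
        (∀ t : T, f.base t ≠ IsLocalRing.closedPoint S → IsRegularLocalRing (T.presheaf.stalk t)) →
        ∃ (Q : Ideal S) (n : ℕ), (IsLocalRing.maximalIdeal S) ^ n ≤ Q ∧
          ∃ (B : Scheme.{0}) (b : B ⟶ Spec (.of S)),
            IsBlowup b (affineBlowup.idealSheaf (I * Q)) ∧ Scheme.IsRegular B)
    (h5 : ∀ (p : ℕ), p.Prime →
      (∀ (k K : Type) [Field k] [CharP k p] [PerfectField k] [Field K] [Algebra k K],
        (⊤ : IntermediateField k K).FG → ∀ O : ValuationSubring K, (∀ c : k, algebraMap k K c ∈ O) →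
          ∀ R : Subalgebra k K, R.FG → R.toSubring ≤ O.toSubring →
            ∃ (A : Subalgebra k K) (h : A.toSubring ≤ O.toSubring), R ≤ A ∧ A.FG ∧
              IsFractionRing A K ∧ IsRegularLocalRing (Localization.AtPrime
                (Ideal.comap (Subring.inclusion h) (IsLocalRing.maximalIdeal O)))) →
      ∀ (k : Type) [Field k] [CharP k p] [PerfectField k] (X : Scheme.{0}) (f : X ⟶ Spec (.of k)),
        IsSeparated f → LocallyOfFiniteType f → QuasiCompact f → IsIntegral X →
        ¬ topologicalKrullDim X ≤ 4 → Scheme.HasResolution X) :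
    Summit.ResolutionOfSingularities.ResolutionOfSingularities.Theses.FrobeniusClosing.PatchingRelPerfect :=
  patchingRelPerfect_of_printed_of_companions_of_dimGeFive hG hP
    (cjs2020BlowupFormat_of_cossartJannsenSaito2020Sequence hS) hQ h5

end Summit.ResolutionOfSingularities.ResolutionOfSingularities.Theorems

end
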